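import Summits.QuantumFields.BalabanUV.T4Continuum.Support.NE7SliceTangentPartLimitNL
import HarnessLib

/-!
# NE7SliceTangentPartLimitNLR — RADIUS-PARAMETRISED RE-ISSUE of `NE7SliceTangentPartLimitNL` (the (LP) hypothesis `hLP` asked on a DISPLAYED sup-radius `b₀` of the chart fields instead of the working-region `1∕8`, so that it is dischargeable from t4-ne7-p1 g103's `NE7FrameDefectLipschitz.norm_frameDefect_sub_frameDefect_le` in the Prop-4 regime at radius `6b₀·M`: `KP := 24·C_Γ·M²·b₀` with `δ := min(bX, 2b₀)`); THE CONTINUITY HALF FOR THE (S1) ITERATION ON THE NONLINEAR FRAME TARGET ((R1′), named ask [NE7P1-G103-ASK-4]): along a sitewise-uniformly convergent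
# orbit whose NL defect `D̃f` tends to zero, the limit `u⋆` has `T̃(u⋆) ∈ 𝒯_E(W)`, matched frames `framePotW T̃(u⋆) = h̃(u⋆)` — i.e. `mlog v_{k+1}(X(u⋆)) = h(u⋆) + framePotW Ñ(u⋆)`,
# (1.37) up to the N-frame — and `m̃(u⋆) = 0`; the p767281 ∕ p768804 argument run on t4-ne7-p1 g103's state maps `NE7SliceIterationStateNL` (`P = frameDefect`, `h̃ = effCornerLog`,
# `φ̃ = coarseDatumNL`, `Ñ = normalPartNL`, `T̃ = tangentPartNL`, `ζ̃, Ỹ`, `m̃ = frameMismatchNL`, `D̃f = sliceDefectNL`)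

Cell `pub-balaban`, rung (B)+1 sub-cell t4, lineage `b2b-balaban-t4-ne7b-p1`, generation 151 (OWNER of BINDER row NE7b; junction service for the NE crew, ruling R-OWNER-149-1 (2)).
A JUNCTION for row NE7 (node U5), asked by name ([NE7P1-G103-INBOX-1] ∕ ROAD-G103 §3).  The ONLY new analytic input relative to the linear chain is the sup-Lipschitz letter of the
frame defect `P(X) = mlog v_{k+1}(X) − framePotW X` in the chart field — the road's (LP) (`NE7FrameDefectLipschitz`, t4-ne7-p1 g103) — which THIS FILE keeps DISPLAYED as the hypothesis
`hLP` with a free constant `KP ≥ 0` (instantiate with (LP) when it lands: on the working region `‖X‖, ‖X′‖ ≤ 1∕8`).  The NL working-region facts that the road's one-step analysis proves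
anyway (skewness of `φ̃(u)`, existence of the normalised split of `(T̃(u), h̃(u))`, `N`-periodicity of the `m̃`-integrand) are likewise DISPLAYED, lemma-shaped (`hskewNL`, `hsplitNL`,
`hperNL`), so nothing of the road's inventory is re-typed here.  Everything else is by name: `NE7SliceTangentPartLimit` (`norm_repLog_sub_le_sup`, `norm_cornerLog_sub_le`,
`norm_coarseDatum_sub_le`), `NE7RightInverseLinear.rightInvW_sub`, R5 `NE3RightInverseSupLetters.norm_rightInvW_le` ∕ `norm_gaugeDir_le_two_mul`, `NE7SliceFrameMatchingLimit.framePotW_sub`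
∕ `norm_framePotW_sub_le`, `NE7EnergySliceClosed.mem_energyBlockLandauW_of_tendsto`, `NE7SliceLimitWorkingRegion.workingRegion_of_limit`, `NE7SliceIterationStateNL.coarseDatumNL_eq`
∕ `normalPartNL_eq` ∕ `splitNL_spec`.
WHAT ([folklore]; 0 def, 0 sorry; multi-level small-field class at `W`, `L ≥ 2`, `M = L^{k+1}`).
§1 two states `u, v` of the working region, `sup‖u − v‖ ≤ ρ`: `norm_frameDefect_sub_le` (`≤ KP·(8∕3)ρ`), `norm_effCornerLog_sub_le`, `norm_coarseDatumNL_sub_le`, `norm_normalPartNL_sub_le`,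
   **`norm_tangentPartNL_sub_le`** (`≤ lipTNL·ρ`), **`norm_frameIntegrandNL_sub_le`** (the `m̃`-integrand is sup-Lipschitz).
§2 one state: `norm_slicePartNL_sub_tangentPartNL_le` (`≤ D̃f(u)`), `norm_frameNL_le_frameMismatchNL` (`≤ m̃(u)`), `frameMismatchNL_le_sliceDefectNL` (`m̃ ≤ M·D̃f`).
§3 the limit, rate shape (working region + NL facts for every `u j` AND for `u⋆`, `‖u j y − u⋆ y‖ ≤ r j → 0`, `D̃f(u j) → 0`): ONE theorem **`limitNLR_of_rate`** —
   `T̃(u⋆) ∈ 𝒯_E(W)` ∧ `framePotW T̃(u⋆) = h̃(u⋆)` ∧ `mlog v_{k+1}(X(u⋆)) = h(u⋆) + framePotW Ñ(u⋆)` ∧ `m̃(u⋆) = 0` ∧ the chosen split of the limit is trivial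
   (`NE7SliceSplitUnique.slice_split_of_mem`) ∧ `D̃f(u⋆) = 0`.
The one-call geometric shape (per-`j` facts, sitewise `Tendsto`, rate `C·ϑ^j`, `D̃f(u j) ≤ ϑ^j·δ₀`; NL facts lemma-shaped) is the companion file `NE7SliceLimitNL`.
HONEST FRAMING (page 1): continuity bookkeeping by name; `hLP`, `hskewNL`, `hsplitNL`, `hperNL` are DISPLAYED hypotheses (the road's (LP) and NL state facts), asserted for nothing here; NOT the
re-issued (S1) engine, NOT (S2), NOT NE7, nothing of row NE7b; spine 0∕9; finite T⁴ rung (B)+1 — NOT infinite volume, NOT mass gap, NOT BetaPertH, NOT Clay.  Continuum YM on T⁴ ⇐ BetaPertH ∧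
nine spine estimates (0/9 proved); BetaPertH ⇐ (D1) ∧ (D4) ∧ CAP+tail; G-an2-4 gates asym, D1 and NE2/3/4.
-/

set_option autoImplicit false

open scoped BigOperators Matrix.Norms.L2Operator Topology
open NormedSpace Finset Filter

namespace Summit.QuantumFields.BalabanUV.T4Continuum.NE7SliceTangentPartLimitNLR

open Literature.MathematicalPhysics.QuantumFieldTheory.Balaban1983to89
open B7Prop1Explicit B7Prop2Explicit MatrixLog
open B7Eq92Concrete (vcov)
open T4AveragingDeficitWall (IsUnitaryCfg IsSkewDir SmallField vary)
open T4AveragingDeficitWallBoundary (IsPeriodicCfg)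
open AveragingDeficitPeriodicCounting (IsPeriodicDir)
open AveragingDeficitMultiLevelPrep (cavgIter LevelSmall tower)
open BlockAveragePushDirGauge (gaugeDir isPeriodicDir_gaugeDir)
open NE3EnergyShapes (IsUnitarySite IsPeriodicSite)
open NE3TangentCovariantTower (framePotW)
open NE3QbarIterCovLiftPrep (cruxC)
open NE3SmoothRightInverseW (rightInvW)
open NE3LinearisedAverageSup (curvSum levelData)
open NE3RightInverseSupLetters (norm_rightInvW_le norm_gaugeDir_le_two_mul supC)
open NE3.PairLandauB8Avg (relPert)
open NE7MeanZeroGaugeSliceW (energyBlockLandauW)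
open NE7RightInverseLinear (rightInvW_sub)
open NE7EnergySliceClosed (mem_energyBlockLandauW_of_tendsto)
open NE7SliceIterationState (repLog cornerLog coarseDatum IsNormalisedSplit siteSup_le siteSup_nonneg le_siteSup bondSup le_bondSup bondSup_le bondSup_nonneg)
open NE3CovariantBlockMean (bmeanIterW)
open NE7SliceIterationStateNL
open NE7SliceTangentPartLimit (norm_repLog_sub_le_sup norm_cornerLog_sub_le norm_coarseDatum_sub_le)
open NE7SliceFrameMatchingLimit (framePotW_sub norm_framePotW_sub_le lipT_nonneg)
open NE7SliceLimitWorkingRegion (workingRegion_of_limit)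
open NE7SliceTangentPartLimitNL (norm_slicePartNL_sub_tangentPartNL_le norm_frameNL_le_frameMismatchNL frameMismatchNL_le_sliceDefectNL)
open NE7SliceSplitUnique (slice_split_of_mem)

noncomputable section

variable {d : ℕ} {n : Type*} [Fintype n] [DecidableEq n] [Nonempty n]

/-! ## §1 Sup-Lipschitz letters between two states of the working region -/

section TwoStates

variable {L : ℕ} (hL : 2 ≤ L) (k : ℕ) {W : Site d → Fin d → (Matrix n n ℂ)ˣ} {x : ℝ} (hWu : IsUnitaryCfg W) (hx : 0 ≤ x) (hs : LevelSmall d L k x)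
  (hWx : SmallField W x) (N : ℕ) [NeZero N] (hθ : cruxC d L * (((L : ℝ) ^ (k + 1)) ^ 2 * x) < 1) (U' : Site d → Fin d → (Matrix n n ℂ)ˣ)
  (hWP : IsPeriodicCfg W ((tower L N (k + 1) : ℕ) : ℤ)) (hU'u : IsUnitaryCfg U') (hU'P : IsPeriodicCfg U' ((tower L N (k + 1) : ℕ) : ℤ))
  (hε : ((L : ℝ) ^ (k + 1)) ^ 2 * x ≤ 1) (hA : curvSum d L (k + 1) x ≤ 2 / 3 * L)
  {b₀ KP : ℝ} (hKP : 0 ≤ KP)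
  (hLP : ∀ (X X' : Site d → Fin d → Matrix n n ℂ) (bX : ℝ), (∀ y κ, ‖X y κ‖ ≤ b₀) → (∀ y κ, ‖X' y κ‖ ≤ b₀) → 0 ≤ bX →
    (∀ y κ, ‖X y κ - X' y κ‖ ≤ bX) → ∀ z : Site d,
      ‖(mlog ((vcov L W (relPert W X) (k + 1) z : (Matrix n n ℂ)ˣ) : Matrix n n ℂ) - framePotW L (k + 1) W X z)
          - (mlog ((vcov L W (relPert W X') (k + 1) z : (Matrix n n ℂ)ˣ) : Matrix n n ℂ) - framePotW L (k + 1) W X' z)‖ ≤ KP * bX)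
  {u v : Site d → (Matrix n n ℂ)ˣ} (hu : IsUnitarySite u) (huP : IsPeriodicSite u ((tower L N (k + 1) : ℕ) : ℤ))
  (hgu : gaugeAct u U' = vary W (repLog W U' u) 1) (hXu : ∀ y κ, ‖repLog W U' u y κ‖ ≤ 1 / 8) (hXbu : ∀ y κ, ‖repLog W U' u y κ‖ ≤ b₀)
  (hcu : ∀ z, ((u (((L : ℤ) ^ (k + 1)) • z) : (Matrix n n ℂ)ˣ) : Matrix n n ℂ) = exp (cornerLog L k u z)) (hhu : ∀ z, ‖cornerLog L k u z‖ ≤ 1 / 8)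
  (hv : IsUnitarySite v) (hvP : IsPeriodicSite v ((tower L N (k + 1) : ℕ) : ℤ))
  (hgv : gaugeAct v U' = vary W (repLog W U' v) 1) (hXv : ∀ y κ, ‖repLog W U' v y κ‖ ≤ 1 / 8) (hXbv : ∀ y κ, ‖repLog W U' v y κ‖ ≤ b₀)
  (hcv : ∀ z, ((v (((L : ℤ) ^ (k + 1)) • z) : (Matrix n n ℂ)ˣ) : Matrix n n ℂ) = exp (cornerLog L k v z)) (hhv : ∀ z, ‖cornerLog L k v z‖ ≤ 1 / 8)
  {ρ : ℝ} (hρ : ∀ y, ‖((u y : (Matrix n n ℂ)ˣ) : Matrix n n ℂ) - (v y : (Matrix n n ℂ)ˣ)‖ ≤ ρ)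

include hWu hU'u hLP hu hv hgu hXu hXbu hgv hXv hXbv hρ in
/-- **THE FRAME DEFECT IS SUP-LIPSCHITZ IN THE GAUGE** on the working region: `‖P(u) z − P(v) z‖ ≤ KP·(8∕3)·sup‖u − v‖` ((LP) displayed + `norm_repLog_sub_le_sup`). [folklore] -/
theorem norm_frameDefect_sub_le (z : Site d) : ‖frameDefect L k W U' u z - frameDefect L k W U' v z‖ ≤ 8 / 3 * KP * ρ := by
  have hρ0 : 0 ≤ ρ := (norm_nonneg _).trans (hρ 0)
  have hX : ∀ y κ, ‖repLog W U' u y κ - repLog W U' v y κ‖ ≤ 8 / 3 * ρ := fun y κ =>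
    norm_repLog_sub_le_sup hWu U' hU'u hu hgu hXu hv hgv hXv hρ y κ
  have h : ‖frameDefect L k W U' u z - frameDefect L k W U' v z‖ ≤ KP * (8 / 3 * ρ) :=
    hLP (repLog W U' u) (repLog W U' v) (8 / 3 * ρ) hXbu hXbv (by positivity) hX z
  linarith

include hWu hU'u hLP hu hv hgu hXu hXbu hgv hXv hXbv hcu hhu hcv hhv hρ in
/-- **THE EFFECTIVE CORNER LOGS ARE SUP-LIPSCHITZ**: `‖h̃(u) z − h̃(v) z‖ ≤ (4∕3 + (8∕3)KP)·sup‖u − v‖`. [folklore] -/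
theorem norm_effCornerLog_sub_le (z : Site d) : ‖effCornerLog L k W U' u z - effCornerLog L k W U' v z‖ ≤ 4 / 3 * ρ + 8 / 3 * KP * ρ := by
  have h1 : ‖cornerLog L k u z - cornerLog L k v z‖ ≤ 4 / 3 * ρ :=
    (norm_cornerLog_sub_le k hcu hhu hcv hhv z).trans (mul_le_mul_of_nonneg_left (hρ _) (by norm_num))
  have h2 := norm_frameDefect_sub_le k hWu U' hU'u hLP hu hgu hXu hXbu hv hgv hXv hXbv hρ z
  have e : effCornerLog L k W U' u z - effCornerLog L k W U' v z
      = (cornerLog L k u z - cornerLog L k v z) - (frameDefect L k W U' u z - frameDefect L k W U' v z) := by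
    simp only [effCornerLog]; abel
  rw [e]
  calc ‖(cornerLog L k u z - cornerLog L k v z) - (frameDefect L k W U' u z - frameDefect L k W U' v z)‖
      ≤ 4 / 3 * ρ + 8 / 3 * KP * ρ := (norm_sub_le _ _).trans (add_le_add h1 h2)

include hL hWu hx hs hWx hWP hU'u hU'P hLP hu huP hgu hXu hXbu hcu hhu hv hvP hgv hXv hXbv hcv hhv hρ hA in
/-- **`sup‖φ̃(u) − φ̃(v)‖ ≤ (8∕3)((3+12d)M + 1 + 2KP)·sup‖u − v‖`** (`φ̃ = φ + gaugeDir_V P`: the old letter `norm_coarseDatum_sub_le` + `norm_gaugeDir_le_two_mul` on `P(u) − P(v)`). [folklore] -/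
theorem norm_coarseDatumNL_sub_le (z : Site d) (κ : Fin d) :
    ‖coarseDatumNL L k W U' u z κ - coarseDatumNL L k W U' v z κ‖ ≤ 8 / 3 * ((3 + 12 * (d : ℝ)) * (L : ℝ) ^ (k + 1) + 1) * ρ + 16 / 3 * KP * ρ := by
  have hL1 : 1 ≤ L := le_trans one_le_two hL
  have h1 := norm_coarseDatum_sub_le hL k hWu hx hs hWx N U' hWP hU'u hU'P hA hu huP hgu hXu hcu hhu hv hvP hgv hXv hcv hhv hρ z κ
  obtain ⟨hVu, -, -, -⟩ := levelData hL1 hWu hx hs hWx (m := k + 1) le_rfl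
  have hP : ∀ w, ‖frameDefect L k W U' u w - frameDefect L k W U' v w‖ ≤ 8 / 3 * KP * ρ := fun w =>
    norm_frameDefect_sub_le k hWu U' hU'u hLP hu hgu hXu hXbu hv hgv hXv hXbv hρ w
  have h2 : ‖gaugeDir (cavgIter L (k + 1) W) (frameDefect L k W U' u) z κ - gaugeDir (cavgIter L (k + 1) W) (frameDefect L k W U' v) z κ‖ ≤ 2 * (8 / 3 * KP * ρ) := by
    have e : gaugeDir (cavgIter L (k + 1) W) (frameDefect L k W U' u) z κ - gaugeDir (cavgIter L (k + 1) W) (frameDefect L k W U' v) z κ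
        = gaugeDir (cavgIter L (k + 1) W) (fun w => frameDefect L k W U' u w - frameDefect L k W U' v w) z κ := by
      simp only [gaugeDir, T4AveragingDeficitNonAbelian.Ad_sub]
      exact (sub_sub_sub_comm _ _ _ _)
    rw [e]
    exact norm_gaugeDir_le_two_mul hVu _ hP z κ
  have e : coarseDatumNL L k W U' u z κ - coarseDatumNL L k W U' v z κ
      = (coarseDatum L k W U' u z κ - coarseDatum L k W U' v z κ)
        + (gaugeDir (cavgIter L (k + 1) W) (frameDefect L k W U' u) z κ - gaugeDir (cavgIter L (k + 1) W) (frameDefect L k W U' v) z κ) := by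
    rw [coarseDatumNL_eq, coarseDatumNL_eq]; abel
  rw [e]
  calc ‖(coarseDatum L k W U' u z κ - coarseDatum L k W U' v z κ)
        + (gaugeDir (cavgIter L (k + 1) W) (frameDefect L k W U' u) z κ - gaugeDir (cavgIter L (k + 1) W) (frameDefect L k W U' v) z κ)‖
      ≤ 8 / 3 * ((3 + 12 * (d : ℝ)) * (L : ℝ) ^ (k + 1) + 1) * ρ + 2 * (8 / 3 * KP * ρ) := (norm_add_le _ _).trans (add_le_add h1 h2)
    _ = 8 / 3 * ((3 + 12 * (d : ℝ)) * (L : ℝ) ^ (k + 1) + 1) * ρ + 16 / 3 * KP * ρ := by ring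

include hL hWu hx hs hWx hWP hU'u hU'P hLP hKP hu huP hgu hXu hXbu hcu hhu hv hvP hgv hXv hXbv hcv hhv hρ hA hε in
/-- **`sup‖Ñ(u) − Ñ(v)‖ ≤ (supC∕(M(1 − cruxC·M²x)))·(8∕3)((3+12d)M + 1 + 2KP)·sup‖u − v‖`** on the working region, given the skewness of `φ̃(u)`, `φ̃(v)` (the road's NL state fact)
(`rightInvW_sub` + (R5)). [folklore] -/
theorem norm_normalPartNL_sub_le (hφu : IsSkewDir (coarseDatumNL L k W U' u)) (hφv : IsSkewDir (coarseDatumNL L k W U' v)) (y : Site d) (μ : Fin d) :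
    ‖normalPartNL hL k hWu hx hs hWx N hθ U' u y μ - normalPartNL hL k hWu hx hs hWx N hθ U' v y μ‖
      ≤ supC d L / ((L : ℝ) ^ (k + 1) * (1 - cruxC d L * (((L : ℝ) ^ (k + 1)) ^ 2 * x)))
        * (8 / 3 * ((3 + 12 * (d : ℝ)) * (L : ℝ) ^ (k + 1) + 1) * ρ + 16 / 3 * KP * ρ) := by
  have hφd : IsSkewDir (fun y μ => coarseDatumNL L k W U' u y μ - coarseDatumNL L k W U' v y μ) := fun y μ =>
    (skewAdjoint (Matrix n n ℂ)).sub_mem (hφu y μ) (hφv y μ)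
  have hρ0 : 0 ≤ ρ := (norm_nonneg _).trans (hρ 0)
  rw [normalPartNL_eq hL k hWu hx hs hWx N hθ U' hφu, normalPartNL_eq hL k hWu hx hs hWx N hθ U' hφv,
    ← rightInvW_sub hL k hWu hx hs hWx hθ hφu hφv hφd y μ]
  have hs0 : 0 ≤ 8 / 3 * ((3 + 12 * (d : ℝ)) * (L : ℝ) ^ (k + 1) + 1) * ρ + 16 / 3 * KP * ρ := by positivity
  exact norm_rightInvW_le hL k hWu hx hs hWx N hθ hε hφd hs0
    (fun z κ => norm_coarseDatumNL_sub_le hL k hWu hx hs hWx N U' hWP hU'u hU'P hA hLP hu huP hgu hXu hXbu hcu hhu hv hvP hgv hXv hXbv hcv hhv hρ z κ) y μ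

include hL hWu hx hs hWx hWP hU'u hU'P hLP hKP hu huP hgu hXu hXbu hcu hhu hv hvP hgv hXv hXbv hcv hhv hρ hA hε in
/-- **THE NL TANGENT PART IS SUP-LIPSCHITZ IN THE GAUGE**: `‖T̃(u)(b) − T̃(v)(b)‖ ≤ lipTNL·sup‖u − v‖`,
`lipTNL = (8∕3)(1 + (supC∕(M(1 − cruxC·M²x)))·((3+12d)M + 1 + 2KP))`. [folklore] -/
theorem norm_tangentPartNL_sub_le (hφu : IsSkewDir (coarseDatumNL L k W U' u)) (hφv : IsSkewDir (coarseDatumNL L k W U' v)) (y : Site d) (μ : Fin d) :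
    ‖tangentPartNL hL k hWu hx hs hWx N hθ U' u y μ - tangentPartNL hL k hWu hx hs hWx N hθ U' v y μ‖
      ≤ (8 / 3 + supC d L / ((L : ℝ) ^ (k + 1) * (1 - cruxC d L * (((L : ℝ) ^ (k + 1)) ^ 2 * x)))
          * (8 / 3 * ((3 + 12 * (d : ℝ)) * (L : ℝ) ^ (k + 1) + 1) + 16 / 3 * KP)) * ρ := by
  have h1 := norm_repLog_sub_le_sup hWu U' hU'u hu hgu hXu hv hgv hXv hρ y μ
  have h2 := norm_normalPartNL_sub_le hL k hWu hx hs hWx N hθ U' hWP hU'u hU'P hε hA hKP hLP hu huP hgu hXu hXbu hcu hhu hv hvP hgv hXv hXbv hcv hhv hρ hφu hφv y μ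
  have e : tangentPartNL hL k hWu hx hs hWx N hθ U' u y μ - tangentPartNL hL k hWu hx hs hWx N hθ U' v y μ
      = (repLog W U' u y μ - repLog W U' v y μ) - (normalPartNL hL k hWu hx hs hWx N hθ U' u y μ - normalPartNL hL k hWu hx hs hWx N hθ U' v y μ) :=
    sub_sub_sub_comm _ _ _ _
  rw [e]
  calc ‖(repLog W U' u y μ - repLog W U' v y μ) - (normalPartNL hL k hWu hx hs hWx N hθ U' u y μ - normalPartNL hL k hWu hx hs hWx N hθ U' v y μ)‖
      ≤ 8 / 3 * ρ + supC d L / ((L : ℝ) ^ (k + 1) * (1 - cruxC d L * (((L : ℝ) ^ (k + 1)) ^ 2 * x)))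
          * (8 / 3 * ((3 + 12 * (d : ℝ)) * (L : ℝ) ^ (k + 1) + 1) * ρ + 16 / 3 * KP * ρ) := (norm_sub_le _ _).trans (add_le_add h1 h2)
    _ = _ := by ring

include hL hWu hx hs hWx hWP hU'u hU'P hLP hKP hu huP hgu hXu hXbu hcu hhu hv hvP hgv hXv hXbv hcv hhv hρ hA hε in
/-- **THE `m̃`-INTEGRAND IS SUP-LIPSCHITZ**: `‖(framePotW T̃(u) z − h̃(u) z) − (framePotW T̃(v) z − h̃(v) z)‖ ≤ (6dM·lipTNL + 4∕3 + (8∕3)KP)·sup‖u − v‖`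
(`norm_framePotW_sub_le` on `T̃(u) − T̃(v)` + `norm_effCornerLog_sub_le`). [folklore] -/
theorem norm_frameIntegrandNL_sub_le (hφu : IsSkewDir (coarseDatumNL L k W U' u)) (hφv : IsSkewDir (coarseDatumNL L k W U' v)) (z : Site d) :
    ‖(framePotW L (k + 1) W (tangentPartNL hL k hWu hx hs hWx N hθ U' u) z - effCornerLog L k W U' u z)
        - (framePotW L (k + 1) W (tangentPartNL hL k hWu hx hs hWx N hθ U' v) z - effCornerLog L k W U' v z)‖
      ≤ (6 * (d : ℝ) * (L : ℝ) ^ (k + 1)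
            * (8 / 3 + supC d L / ((L : ℝ) ^ (k + 1) * (1 - cruxC d L * (((L : ℝ) ^ (k + 1)) ^ 2 * x)))
              * (8 / 3 * ((3 + 12 * (d : ℝ)) * (L : ℝ) ^ (k + 1) + 1) + 16 / 3 * KP))
          + 4 / 3 + 8 / 3 * KP) * ρ := by
  have hρ0 : 0 ≤ ρ := (norm_nonneg _).trans (hρ 0)
  have hlip : 0 ≤ 8 / 3 + supC d L / ((L : ℝ) ^ (k + 1) * (1 - cruxC d L * (((L : ℝ) ^ (k + 1)) ^ 2 * x)))
      * (8 / 3 * ((3 + 12 * (d : ℝ)) * (L : ℝ) ^ (k + 1) + 1) + 16 / 3 * KP) := by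
    have hsupC : 0 ≤ supC d L := by
      unfold supC NE3RightInverseSupLetters.corrC NE3RightInverseSupLetters.frameC; have := NE3QbarIterCovLiftPrep.liftC_nonneg d; positivity
    have hM : 0 < (L : ℝ) ^ (k + 1) := pow_pos (by exact_mod_cast (by omega : 0 < L)) _
    have hden : 0 < (L : ℝ) ^ (k + 1) * (1 - cruxC d L * (((L : ℝ) ^ (k + 1)) ^ 2 * x)) := mul_pos hM (by linarith)
    have h1 : 0 ≤ supC d L / ((L : ℝ) ^ (k + 1) * (1 - cruxC d L * (((L : ℝ) ^ (k + 1)) ^ 2 * x))) := div_nonneg hsupC hden.le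
    positivity
  have h1 := norm_framePotW_sub_le hL k hWu hx hs hWx hA (mul_nonneg hlip hρ0)
    (fun y μ => norm_tangentPartNL_sub_le hL k hWu hx hs hWx N hθ U' hWP hU'u hU'P hε hA hKP hLP hu huP hgu hXu hXbu hcu hhu hv hvP hgv hXv hXbv hcv hhv hρ hφu hφv y μ) z
  have h2 := norm_effCornerLog_sub_le k hWu U' hU'u hLP hu hgu hXu hXbu hcu hhu hv hgv hXv hXbv hcv hhv hρ z
  have e : (framePotW L (k + 1) W (tangentPartNL hL k hWu hx hs hWx N hθ U' u) z - effCornerLog L k W U' u z)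
        - (framePotW L (k + 1) W (tangentPartNL hL k hWu hx hs hWx N hθ U' v) z - effCornerLog L k W U' v z)
      = (framePotW L (k + 1) W (tangentPartNL hL k hWu hx hs hWx N hθ U' u) z - framePotW L (k + 1) W (tangentPartNL hL k hWu hx hs hWx N hθ U' v) z)
        - (effCornerLog L k W U' u z - effCornerLog L k W U' v z) := sub_sub_sub_comm _ _ _ _
  rw [e]
  calc ‖(framePotW L (k + 1) W (tangentPartNL hL k hWu hx hs hWx N hθ U' u) z - framePotW L (k + 1) W (tangentPartNL hL k hWu hx hs hWx N hθ U' v) z)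
        - (effCornerLog L k W U' u z - effCornerLog L k W U' v z)‖
      ≤ 6 * (d : ℝ) * (L : ℝ) ^ (k + 1)
            * ((8 / 3 + supC d L / ((L : ℝ) ^ (k + 1) * (1 - cruxC d L * (((L : ℝ) ^ (k + 1)) ^ 2 * x)))
              * (8 / 3 * ((3 + 12 * (d : ℝ)) * (L : ℝ) ^ (k + 1) + 1) + 16 / 3 * KP)) * ρ)
          + (4 / 3 * ρ + 8 / 3 * KP * ρ) := (norm_sub_le _ _).trans (add_le_add h1 h2)
    _ = _ := by ring

end TwoStates

/-! ## §2 One state: the access letters `norm_slicePartNL_sub_tangentPartNL_le`, `norm_frameNL_le_frameMismatchNL`, `frameMismatchNL_le_sliceDefectNL` are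
`NE7SliceTangentPartLimitNL`'s (imported by name). -/

/-! ## §3 The limit — rate shape -/

section Limit

variable {L : ℕ} (hL : 2 ≤ L) (k : ℕ) {W : Site d → Fin d → (Matrix n n ℂ)ˣ} {x : ℝ} (hWu : IsUnitaryCfg W) (hx : 0 ≤ x) (hs : LevelSmall d L k x)
  (hWx : SmallField W x) (N : ℕ) [NeZero N] (hθ : cruxC d L * (((L : ℝ) ^ (k + 1)) ^ 2 * x) < 1) (U' : Site d → Fin d → (Matrix n n ℂ)ˣ)
  (hWP : IsPeriodicCfg W ((tower L N (k + 1) : ℕ) : ℤ)) (hU'u : IsUnitaryCfg U') (hU'P : IsPeriodicCfg U' ((tower L N (k + 1) : ℕ) : ℤ))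
  (hε : ((L : ℝ) ^ (k + 1)) ^ 2 * x ≤ 1) (hA : curvSum d L (k + 1) x ≤ 2 / 3 * L)
  {b₀ KP : ℝ} (hKP : 0 ≤ KP)
  (hLP : ∀ (X X' : Site d → Fin d → Matrix n n ℂ) (bX : ℝ), (∀ y κ, ‖X y κ‖ ≤ b₀) → (∀ y κ, ‖X' y κ‖ ≤ b₀) → 0 ≤ bX →
    (∀ y κ, ‖X y κ - X' y κ‖ ≤ bX) → ∀ z : Site d,
      ‖(mlog ((vcov L W (relPert W X) (k + 1) z : (Matrix n n ℂ)ˣ) : Matrix n n ℂ) - framePotW L (k + 1) W X z)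
          - (mlog ((vcov L W (relPert W X') (k + 1) z : (Matrix n n ℂ)ˣ) : Matrix n n ℂ) - framePotW L (k + 1) W X' z)‖ ≤ KP * bX)
  (u : ℕ → Site d → (Matrix n n ℂ)ˣ) (ulim : Site d → (Matrix n n ℂ)ˣ)
  (hu : ∀ j, IsUnitarySite (u j)) (huP : ∀ j, IsPeriodicSite (u j) ((tower L N (k + 1) : ℕ) : ℤ))
  (hgu : ∀ j, gaugeAct (u j) U' = vary W (repLog W U' (u j)) 1) (hXu : ∀ j y κ, ‖repLog W U' (u j) y κ‖ ≤ 1 / 8) (hXbj : ∀ j y κ, ‖repLog W U' (u j) y κ‖ ≤ b₀)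
  (hcu : ∀ j z, (((u j) (((L : ℤ) ^ (k + 1)) • z) : (Matrix n n ℂ)ˣ) : Matrix n n ℂ) = exp (cornerLog L k (u j) z)) (hhu : ∀ j z, ‖cornerLog L k (u j) z‖ ≤ 1 / 8)
  (hl : IsUnitarySite ulim) (hlP : IsPeriodicSite ulim ((tower L N (k + 1) : ℕ) : ℤ))
  (hgl : gaugeAct ulim U' = vary W (repLog W U' ulim) 1) (hXl : ∀ y κ, ‖repLog W U' ulim y κ‖ ≤ 1 / 8) (hXbl : ∀ y κ, ‖repLog W U' ulim y κ‖ ≤ b₀)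
  (hcl : ∀ z, ((ulim (((L : ℤ) ^ (k + 1)) • z) : (Matrix n n ℂ)ˣ) : Matrix n n ℂ) = exp (cornerLog L k ulim z)) (hhl : ∀ z, ‖cornerLog L k ulim z‖ ≤ 1 / 8)
  -- the road's NL state facts along the orbit and at the limit, displayed
  (hφj : ∀ j, IsSkewDir (coarseDatumNL L k W U' (u j))) (hφl : IsSkewDir (coarseDatumNL L k W U' ulim))
  (hexj : ∀ j, ∃ p : (Site d → Matrix n n ℂ) × (Site d → Fin d → Matrix n n ℂ),
      IsNormalisedSplit L k N W (tangentPartNL hL k hWu hx hs hWx N hθ U' (u j)) (effCornerLog L k W U' (u j)) p.1 p.2)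
  (hperj : ∀ j (z : Site d) (i : Fin d),
      framePotW L (k + 1) W (tangentPartNL hL k hWu hx hs hWx N hθ U' (u j)) (z + (N : ℤ) • e i) - effCornerLog L k W U' (u j) (z + (N : ℤ) • e i)
        = framePotW L (k + 1) W (tangentPartNL hL k hWu hx hs hWx N hθ U' (u j)) z - effCornerLog L k W U' (u j) z)
  (r : ℕ → ℝ) (hrate : ∀ j y, ‖(((u j) y : (Matrix n n ℂ)ˣ) : Matrix n n ℂ) - (ulim y : (Matrix n n ℂ)ˣ)‖ ≤ r j) (hr : Tendsto r atTop (𝓝 0))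
  (hDf : Tendsto (fun j => sliceDefectNL hL k hWu hx hs hWx N hθ U' (u j)) atTop (𝓝 0))

  (hexl : ∃ p : (Site d → Matrix n n ℂ) × (Site d → Fin d → Matrix n n ℂ),
      IsNormalisedSplit L k N W (tangentPartNL hL k hWu hx hs hWx N hθ U' ulim) (effCornerLog L k W U' ulim) p.1 p.2)

include hWP hU'u hU'P hε hA hKP hLP hu huP hgu hXu hXbj hcu hhu hl hlP hgl hXl hXbl hcl hhl hφj hφl hexj hrate hr hDf in
/-- `T̃(u⋆) ∈ 𝒯_E(W)` (helper; the public statement is `limitNLR_of_rate`). [folklore] -/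
private theorem tangentPartNL_limit_mem' : tangentPartNL hL k hWu hx hs hWx N hθ U' ulim ∈ energyBlockLandauW (d := d) (n := n) L N (k + 1) W := by
  obtain ⟨C, hC⟩ : ∃ C : ℝ, C = 8 / 3 + supC d L / ((L : ℝ) ^ (k + 1) * (1 - cruxC d L * (((L : ℝ) ^ (k + 1)) ^ 2 * x)))
      * (8 / 3 * ((3 + 12 * (d : ℝ)) * (L : ℝ) ^ (k + 1) + 1) + 16 / 3 * KP) := ⟨_, rfl⟩
  refine mem_energyBlockLandauW_of_tendsto hL k hWu hx hs hWx (Y := fun j => slicePartNL hL k hWu hx hs hWx N hθ U' (u j))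
    (fun j => (splitNL_spec hL k hWu hx hs hWx N hθ U' (hexj j)).2.2.1) fun y μ => ?_
  have hbound : ∀ j, ‖slicePartNL hL k hWu hx hs hWx N hθ U' (u j) y μ - tangentPartNL hL k hWu hx hs hWx N hθ U' ulim y μ‖
      ≤ sliceDefectNL hL k hWu hx hs hWx N hθ U' (u j) + C * r j := fun j => by
    have h1 := norm_slicePartNL_sub_tangentPartNL_le hL k hWu hx hs hWx N hθ U' hWP (hexj j) y μ
    have h2 := norm_tangentPartNL_sub_le hL k hWu hx hs hWx N hθ U' hWP hU'u hU'P hε hA hKP hLP (hu j) (huP j) (hgu j) (hXu j) (hXbj j) (hcu j) (hhu j)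
      hl hlP hgl hXl hXbl hcl hhl (hrate j) (hφj j) hφl y μ
    calc ‖slicePartNL hL k hWu hx hs hWx N hθ U' (u j) y μ - tangentPartNL hL k hWu hx hs hWx N hθ U' ulim y μ‖
        ≤ ‖slicePartNL hL k hWu hx hs hWx N hθ U' (u j) y μ - tangentPartNL hL k hWu hx hs hWx N hθ U' (u j) y μ‖
          + ‖tangentPartNL hL k hWu hx hs hWx N hθ U' (u j) y μ - tangentPartNL hL k hWu hx hs hWx N hθ U' ulim y μ‖ := norm_sub_le_norm_sub_add_norm_sub _ _ _
      _ ≤ sliceDefectNL hL k hWu hx hs hWx N hθ U' (u j) + C * r j := add_le_add h1 (by rw [hC]; exact h2)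
  have hlim0 : Tendsto (fun j => sliceDefectNL hL k hWu hx hs hWx N hθ U' (u j) + C * r j) atTop (𝓝 0) := by
    have := hDf.add (hr.const_mul C)
    simpa using this
  rw [tendsto_iff_norm_sub_tendsto_zero]
  exact squeeze_zero (fun j => norm_nonneg _) hbound hlim0

include hWP hU'u hU'P hε hA hKP hLP hu huP hgu hXu hXbj hcu hhu hl hlP hgl hXl hXbl hcl hhl hφj hφl hperj hrate hr hDf in
/-- `framePotW T̃(u⋆) z = h̃(u⋆) z` (helper; the public statement is `limitNLR_of_rate`). [folklore] -/
private theorem framePotW_NL_limit_eq' (z : Site d) :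
    framePotW L (k + 1) W (tangentPartNL hL k hWu hx hs hWx N hθ U' ulim) z = effCornerLog L k W U' ulim z := by
  obtain ⟨C, hC⟩ : ∃ C : ℝ, C = 6 * (d : ℝ) * (L : ℝ) ^ (k + 1)
      * (8 / 3 + supC d L / ((L : ℝ) ^ (k + 1) * (1 - cruxC d L * (((L : ℝ) ^ (k + 1)) ^ 2 * x)))
        * (8 / 3 * ((3 + 12 * (d : ℝ)) * (L : ℝ) ^ (k + 1) + 1) + 16 / 3 * KP))
      + 4 / 3 + 8 / 3 * KP := ⟨_, rfl⟩
  have hlim0 : Tendsto (fun j => (L : ℝ) ^ (k + 1) * sliceDefectNL hL k hWu hx hs hWx N hθ U' (u j) + C * r j) atTop (𝓝 0) := by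
    simpa using (hDf.const_mul ((L : ℝ) ^ (k + 1))).add (hr.const_mul C)
  -- the finite-`j` letter: constant left-hand side bounded by a null sequence
  have hstep : ∀ j, ‖framePotW L (k + 1) W (tangentPartNL hL k hWu hx hs hWx N hθ U' ulim) z - effCornerLog L k W U' ulim z‖
      ≤ (L : ℝ) ^ (k + 1) * sliceDefectNL hL k hWu hx hs hWx N hθ U' (u j) + C * r j := by
    intro j
    have h1 : ‖framePotW L (k + 1) W (tangentPartNL hL k hWu hx hs hWx N hθ U' (u j)) z - effCornerLog L k W U' (u j) z‖
        ≤ (L : ℝ) ^ (k + 1) * sliceDefectNL hL k hWu hx hs hWx N hθ U' (u j) :=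
      (norm_frameNL_le_frameMismatchNL hL k hWu hx hs hWx N hθ U' (hperj j) z).trans (frameMismatchNL_le_sliceDefectNL hL k hWu hx hs hWx N hθ U' (u j))
    have h2 := norm_frameIntegrandNL_sub_le hL k hWu hx hs hWx N hθ U' hWP hU'u hU'P hε hA hKP hLP (hu j) (huP j) (hgu j) (hXu j) (hXbj j) (hcu j) (hhu j)
      hl hlP hgl hXl hXbl hcl hhl (hrate j) (hφj j) hφl z
    rw [hC]
    calc ‖framePotW L (k + 1) W (tangentPartNL hL k hWu hx hs hWx N hθ U' ulim) z - effCornerLog L k W U' ulim z‖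
        = ‖(framePotW L (k + 1) W (tangentPartNL hL k hWu hx hs hWx N hθ U' (u j)) z - effCornerLog L k W U' (u j) z)
          - ((framePotW L (k + 1) W (tangentPartNL hL k hWu hx hs hWx N hθ U' (u j)) z - effCornerLog L k W U' (u j) z)
            - (framePotW L (k + 1) W (tangentPartNL hL k hWu hx hs hWx N hθ U' ulim) z - effCornerLog L k W U' ulim z))‖ := by
          congr 1; abel
      _ ≤ ‖framePotW L (k + 1) W (tangentPartNL hL k hWu hx hs hWx N hθ U' (u j)) z - effCornerLog L k W U' (u j) z‖
          + ‖(framePotW L (k + 1) W (tangentPartNL hL k hWu hx hs hWx N hθ U' (u j)) z - effCornerLog L k W U' (u j) z)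
            - (framePotW L (k + 1) W (tangentPartNL hL k hWu hx hs hWx N hθ U' ulim) z - effCornerLog L k W U' ulim z)‖ := norm_sub_le _ _
      _ ≤ _ := add_le_add h1 h2
  exact sub_eq_zero.mp (norm_le_zero_iff.mp (ge_of_tendsto' hlim0 hstep))

include hWP hU'u hU'P hε hA hKP hLP hu huP hgu hXu hXbj hcu hhu hl hlP hgl hXl hXbl hcl hhl hφj hφl hexj hexl hperj hrate hr hDf in
/-- **THE (R1′) LIMIT, RATE SHAPE — `T̃(u⋆) ∈ 𝒯_E(W)`, matched effective frames `framePotW T̃(u⋆) = h̃(u⋆)`, (1.37) up to the N-frame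
`mlog v_{k+1}(X(u⋆)) = h(u⋆) + framePotW Ñ(u⋆)`, `m̃(u⋆) = 0`, the chosen split of the limit is trivial (`Ỹ̃(u⋆) = T̃(u⋆)`, `gaugeDir W ζ̃(u⋆) = 0`) and `D̃f(u⋆) = 0`.**
Hypotheses: class at `W`, the road's (LP) on the radius `b₀` (`hLP`, `KP ≥ 0`), working region + NL state facts for every `u j` and for `u⋆` (incl. the orbit bounds `‖X‖ ≤ b₀`), uniform rate
`r j → 0`, `D̃f(u j) → 0`. [folklore] -/
theorem limitNLR_of_rate :
    tangentPartNL hL k hWu hx hs hWx N hθ U' ulim ∈ energyBlockLandauW (d := d) (n := n) L N (k + 1) W ∧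
      framePotW L (k + 1) W (tangentPartNL hL k hWu hx hs hWx N hθ U' ulim) = effCornerLog L k W U' ulim ∧
      (∀ z, mlog ((vcov L W (relPert W (repLog W U' ulim)) (k + 1) z : (Matrix n n ℂ)ˣ) : Matrix n n ℂ)
        = cornerLog L k ulim z + framePotW L (k + 1) W (normalPartNL hL k hWu hx hs hWx N hθ U' ulim) z) ∧
      frameMismatchNL hL k hWu hx hs hWx N hθ U' ulim = 0 ∧
      ((∀ y μ, slicePartNL hL k hWu hx hs hWx N hθ U' ulim y μ = tangentPartNL hL k hWu hx hs hWx N hθ U' ulim y μ) ∧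
        ∀ y μ, gaugeDir W (gaugeFunNL hL k hWu hx hs hWx N hθ U' ulim) y μ = 0) ∧
      sliceDefectNL hL k hWu hx hs hWx N hθ U' ulim = 0 := by
  haveI : NeZero L := ⟨by omega⟩
  have hT := tangentPartNL_limit_mem' hL k hWu hx hs hWx N hθ U' hWP hU'u hU'P hε hA hKP hLP u ulim hu huP hgu hXu hXbj hcu hhu hl hlP hgl hXl hXbl hcl hhl
    hφj hφl hexj r hrate hr hDf
  have hF := framePotW_NL_limit_eq' hL k hWu hx hs hWx N hθ U' hWP hU'u hU'P hε hA hKP hLP u ulim hu huP hgu hXu hXbj hcu hhu hl hlP hgl hXl hXbl hcl hhl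
    hφj hφl hperj r hrate hr hDf
  -- (1.37) up to the N-frame: `F X − F Ñ = h − (mlog v − F X)` ⟹ `mlog v = h + F Ñ`
  have hv : ∀ z, mlog ((vcov L W (relPert W (repLog W U' ulim)) (k + 1) z : (Matrix n n ℂ)ˣ) : Matrix n n ℂ)
      = cornerLog L k ulim z + framePotW L (k + 1) W (normalPartNL hL k hWu hx hs hWx N hθ U' ulim) z := fun z => by
    have h1 := hF z
    have hTsub : framePotW L (k + 1) W (tangentPartNL hL k hWu hx hs hWx N hθ U' ulim) z
        = framePotW L (k + 1) W (repLog W U' ulim) z - framePotW L (k + 1) W (normalPartNL hL k hWu hx hs hWx N hθ U' ulim) z :=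
      framePotW_sub hL k hWu hx hs hWx (repLog W U' ulim) (normalPartNL hL k hWu hx hs hWx N hθ U' ulim) z
    rw [hTsub] at h1
    have hh : effCornerLog L k W U' ulim z = cornerLog L k ulim z
        - (mlog ((vcov L W (relPert W (repLog W U' ulim)) (k + 1) z : (Matrix n n ℂ)ˣ) : Matrix n n ℂ) - framePotW L (k + 1) W (repLog W U' ulim) z) := rfl
    rw [hh] at h1
    have := sub_eq_zero.mpr h1
    rw [← sub_eq_zero, ← this]; abel
  -- `m̃(u⋆) = 0`
  have hm : frameMismatchNL hL k hWu hx hs hWx N hθ U' ulim = 0 :=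
    le_antisymm (siteSup_le (Nat.one_le_iff_ne_zero.mpr (NeZero.ne N)) fun z => by rw [hF z, sub_self, norm_zero]) (siteSup_nonneg fun z => norm_nonneg _)
  -- the chosen split of the limit is a split of a slice element with mean-zero gauge function: trivial
  obtain ⟨hζs, hζP, hY, hsplit, hmean⟩ := splitNL_spec hL k hWu hx hs hWx N hθ U' hexl
  have hmean0 : bmeanIterW L (k + 1) W (gaugeFunNL hL k hWu hx hs hWx N hθ U' ulim) = 0 := by
    funext z; rw [Pi.zero_apply, hmean z, hF z, sub_self, neg_zero]
  have htriv := slice_split_of_mem k hWP hT hY hζs hζP hsplit hmean0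
  -- zero defect
  have hM : 0 < (L : ℝ) ^ (k + 1) := pow_pos (by exact_mod_cast (by omega : 0 < L)) _
  have hP1 : 1 ≤ tower L N (k + 1) := Nat.one_le_iff_ne_zero.mpr (NeZero.ne _)
  have hδ : bondSup (tower L N (k + 1)) (fun y μ => ‖gaugeDir W (gaugeFunNL hL k hWu hx hs hWx N hθ U' ulim) y μ‖) = 0 :=
    le_antisymm (bondSup_le hP1 le_rfl fun y μ => by rw [htriv.2 y μ, norm_zero]) (bondSup_nonneg fun y μ => norm_nonneg _)
  have hD : sliceDefectNL hL k hWu hx hs hWx N hθ U' ulim = 0 := by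
    unfold sliceDefectNL; rw [hδ, hm, zero_div, add_zero]
  exact ⟨hT, funext hF, hv, hm, htriv, hD⟩

end Limit

end

end Summit.QuantumFields.BalabanUV.T4Continuum.NE7SliceTangentPartLimitNLR
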